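import Summits.CriticalPhenomena.CardyFormulaZ2.Theorems.CardyComplexConeEdgePrecompactUFRSStartPairReturn

/-!
# Arm domination, the START-PAIR final merge: the exploration's continuation returns to the translate's run
(line `qkz-strip-boundary-arm` of crux `CardyComplexCone.EdgePrecompact`, stmt-CriticalPhenomena-11387;
twin of `…UFRSStartPairReturn.lean` with the roles of the datum `E` and of its translate exchanged; see the
module docstring there for the setting — the START pair `a`, `a'`, the good first stretch `S₀ = O₀ a [0, n]`
into the `2ρ`-deep ball, the run `R₁ = O₁ a' [0, T]` of the translate's completion off the ball with
`O₁ a' T = O₀ a n = x₀` (FINAL MERGE) — and for the role of these case lemmas in the planar analysis of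
the shared residual of `ufrs_initialContactCase_certJ` / `ufrs_slippedReturnCase_certJ`)

`ufrs_finalMerge_return0_ST` (registered): if the continuation `O₀ a (n, u]` of the exploration of `E`
(inner faces of `E`) MEETS the run `R₁` at time `u`, or its vertex at time `u` is within `4η` of the
translate's start vertex `a'.1 = a.1 + w`, then `ω ∈ ufrsCert E w z (4η) (ρ/2)` at a collar point
`z ∈ D`: outside the escape regime, at the FIRST return `O₀ a u' = O₁ a' k'` (`n < u' ≤ u`) one has
`k' < T` and `u' ≥ n + 2` (the corner after `x₀` starts in the ball, which the run avoids, and the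
translate's marked edge `cSrc a'` is within `4η + E.δ < ρ` of `∂D`), so either `k' = 0` (passage through
`a'`: NEAR at `E.δ a.1` from the run and the continuation, both within `5η`) or `cTgt (O₀ a (u' - 1))` is a
merge edge at a collar corner (`ufrs_mergeCollar`) carrying the pairwise corner-disjoint pieces
`O₁ a' [k', T]` (to the ball), `O₀ a [n + 1, u' - 1]` (from the ball) and `O₁ a' [0, k' - 2]` (back to the
marked edge `cSrc a'` of `shiftData E w`): FAR or MARKED/NEAR; with no return before `u`, NEAR at `E.δ a.1`.
No hypothesis on turning numbers is used.

References: S. Smirnov, C. R. Acad. Sci. Paris 333 (2001), §2; G. Grimmett, *Percolation* (1999),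
§11.2; P. Nolin, Electron. J. Probab. 13 (2008), §4.
-/

set_option linter.unusedVariables false

namespace Summit.CriticalPhenomena.CardyFormulaZ2.Cruxes.EdgePrecompact.QkzStripBoundaryArm

open MeasureTheory Filter Set Metric
open scoped Topology BigOperators Pointwise
open Literature.Probability.LatticeModels Literature.Probability.Percolation
open Literature.Probability.RandomPlanarGeometry (DobrushinDomain)
open Summit.CriticalPhenomena.CardyFormulaZ2.Theses.CardyComplexCone

noncomputable section

/-! ## The exploration's continuation returns to the run or to the translate's start vertex -/

/-- **START-PAIR final merge, the exploration's continuation returns: the certificate** (registered helper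
`ufrs_finalMerge_return0_ST` of stmt-CriticalPhenomena-11387; the twin of `ufrs_finalMerge_return1_ST` with
the two data exchanged). DATA: the start pair, the good first stretch `O₀ a [0, n]` entering the `2ρ`-deep
ball at `n`, the run `O₁ a' [0, T]` off the ball through the translate's inner faces with
`O₁ a' T = O₀ a n`, and a continuation `O₀ a (n, u]` through inner faces of `E` which at time `u` sits ON
the run or has its vertex within `4η` of the translate's start vertex `a'.1`. CONCLUSION:
`ω ∈ ufrsCert E w z (4η) (ρ/2)` at a collar point `z ∈ D`. PROOF: outside the escape regime take the first
return `O₀ a u' = O₁ a' k'` (`n < u' ≤ u`): `k' < T`, `u' ≥ n + 2` (the corner after `x₀` starts in the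
ball, the run avoids the ball, and `cSrc a'` is within `4η + E.δ < ρ` of `∂D`); `k' = 0` is a passage
through `a'` (NEAR at `E.δ a.1` from the run and the continuation), otherwise `cTgt (O₀ a (u' - 1))` is a
merge edge at a collar corner carrying `O₁ a' [k', T]` (to the ball), `O₀ a [n + 1, u' - 1]` (from the
ball) and `O₁ a' [0, k' - 2]` (back to the marked edge `cSrc a'` of the translate): FAR or MARKED/NEAR;
with no return before `u`, NEAR at `E.δ a.1`. -/
theorem ufrs_finalMerge_return0_ST : ∀ (D : DobrushinDomain) (η : ℝ), 0 < η → ∃ δ₀ > (0:ℝ), ∀ E : DiscreteDobrushin, E.Ω = D.carrier → E.IsZdAdmissible → E.δ < δ₀ → ∀ (v w : Site 2) (ρ : ℝ), 4 * η ≤ ρ → 2 * ρ ≤ infDist (meshPoint E.δ v) D.carrierᶜ → ‖meshPoint E.δ w‖ < η → ∀ (ω : BondConfig (Site 2)) (a a' : Site 2 × Fin 4) (n T u : ℕ), E.IsStartCorner a → (shiftData E w).IsStartCorner a' → (∀ i < n, medialPoint E.δ (cTgt (cornerOrbit (E.bcBondConfig ω) a i)) ∉ ball (meshPoint E.δ v)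 ρ ∧ E.IsInnerFace (cFace (cornerOrbit (E.bcBondConfig ω) a (i + 1)))) → medialPoint E.δ (cTgt (cornerOrbit (E.bcBondConfig ω) a n)) ∈ ball (meshPoint E.δ v) ρ → (∀ i < T, medialPoint E.δ (cTgt (cornerOrbit ((shiftData E w).bcBondConfig ω) a' i)) ∉ ball (meshPoint E.δ v) ρ ∧ (shiftData E w).IsInnerFace (cFace (cornerOrbit ((shiftData E w).bcBondConfig ω) a' (i + 1)))) → cornerOrbit ((shiftData E w).bcBondConfig ω) a' T = cornerOrbit (E.bcBondConfig ω) a n → n < u → (∀ t, n < t → t ≤ u → E.IsInnerFace (cFace (cornerOrbit (E.bcBondConfig ω) a t))) → ((∃ k ≤ T, cornerOrbit (E.bcBondConfig ω) a u = cornerOrbit ((shiftData E w).bcBondConfig ω) a' k) ∨ dist (meshPoint E.δ (cornerOrbit (E.bcBondConfig ω) a u).1) (meshPoint E.δ a'.1) ≤ 4 * η) → ∃ z ∈ D.carrier, infDist z D.carrierᶜ < 3 * η ∧ ω ∈ ufrsCert E w z (4 * η) (ρ / 2) := by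
  classical
  intro D η hη
  obtain ⟨δ₁, hδ₁, hmerge⟩ := ufrs_mergeCollar D η hη
  obtain ⟨δ₂, hδ₂, hcollar⟩ := collarAgreement D η hη
  refine ⟨min δ₁ (min δ₂ η), lt_min hδ₁ (lt_min hδ₂ hη), ?_⟩
  intro E hEΩ hE hEδ v w ρ hηρ hv hw ω a a' n T u ha ha' hStr hball hrun hmergeT hnu hcont hret
  have hδ : 0 < E.δ := hE.delta_pos
  have hδ₁' : E.δ < δ₁ := lt_of_lt_of_le hEδ (min_le_left _ _)
  have hδ₂' : E.δ < δ₂ := lt_of_lt_of_le hEδ ((min_le_right _ _).trans (min_le_left _ _))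
  have hδη : E.δ ≤ η := (lt_of_lt_of_le hEδ ((min_le_right _ _).trans (min_le_right _ _))).le
  have hE₁ : (shiftData E w).IsZdAdmissible := isZdAdmissible_shiftData E w hE
  set β₀ := E.bcBondConfig ω with hβ₀
  set β₁ := (shiftData E w).bcBondConfig ω with hβ₁
  -- the translate's start vertex is the translated start vertex
  have ha'eq : a' = (a.1 + w, a.2) := eq_shift_of_isStartCorner hE ha ha'
  have ha'near : dist (meshPoint E.δ a'.1) (meshPoint E.δ a.1) ≤ η := by
    rw [ha'eq, meshPoint_add_shift, dist_eq_norm, add_sub_cancel_right]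
    exact hw.le
  -- faces and simplicity
  have hinner : ∀ x : Site 2, 3 * η ≤ infDist (meshPoint E.δ x) D.carrierᶜ → ∀ f : Site 2, IsCorner x f → E.IsInnerFace f ∧ (shiftData E w).IsInnerFace f :=
    fun x hx => (hcollar E hEΩ hE hδ₂' w hw ω x hx x (by rw [dist_self]; positivity)).2
  have hfaceE : ∀ t ≤ u, E.IsInnerFace (cFace (cornerOrbit β₀ a t)) := by
    intro t ht
    rcases Nat.eq_zero_or_pos t with rfl | hpos
    · exact ha.isOutEdge.1
    · rcases Nat.lt_or_ge n t with hnt | htn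
      · exact hcont t hnt ht
      · obtain ⟨t', rfl⟩ : ∃ t', t = t' + 1 := ⟨t - 1, by omega⟩
        exact (hStr t' (by omega)).2
  have hface₁ : ∀ t ≤ T, (shiftData E w).IsInnerFace (cFace (cornerOrbit β₁ a' t)) := by
    intro t ht
    rcases Nat.eq_zero_or_pos t with rfl | hpos
    · exact ha'.isOutEdge.1
    · obtain ⟨t', rfl⟩ : ∃ t', t = t' + 1 := ⟨t - 1, by omega⟩
      exact (hrun t' (by omega)).2
  have hsimple : ∀ s t, s < t → t ≤ u → cornerOrbit β₀ a s ≠ cornerOrbit β₀ a t :=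
    fun s t hst htu => cornerOrbit_ne hE ha hst (fun k hk => hfaceE k (by omega))
  have hsimple₁ : ∀ s t, s < t → t ≤ T → cornerOrbit β₁ a' s ≠ cornerOrbit β₁ a' t :=
    fun s t hst htT => cornerOrbit_ne hE₁ ha' hst (fun k hk => hface₁ k (by omega))
  have hzD : ∀ t ≤ u, meshPoint E.δ (cornerOrbit β₀ a t).1 ∈ D.carrier := by
    intro t ht
    rw [← hEΩ]
    exact (ufrs_discrepancyEdges E w ω).2.2 _ (hfaceE t ht)
  have hcola : infDist (meshPoint E.δ a.1) D.carrierᶜ < 3 * η := by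
    by_contra h
    rw [not_lt] at h
    exact ha.isOutEdge.2 (hinner a.1 h (faceAt a.1 (a.2 + 3)) (isCorner_faceAt _ _)).1
  have haD : meshPoint E.δ a.1 ∈ D.carrier := hzD 0 (Nat.zero_le _)
  -- escape regime
  by_cases hesc : ρ / 2 < 256 * (4 * η)
  · exact ⟨_, haD, hcola, mem_ufrsCert_of_lt_W3H hesc⟩
  rw [not_lt] at hesc
  -- far ends: next to the ball
  have hfar : ∀ (c y : Site 2) (p : Site 2 × Fin 4), infDist (meshPoint E.δ c) D.carrierᶜ < 3 * η →
      medialPoint E.δ (cTgt p) ∈ ball (meshPoint E.δ v) ρ → dist (meshPoint E.δ y) (meshPoint E.δ p.1) ≤ E.δ →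
      ρ / 2 / 2 ≤ dist (meshPoint E.δ y) (meshPoint E.δ c) := by
    intro c y p hc hp hy
    have := far_of_near_cTgt_mem_ball_W3H hδ.le hv hc (z := meshPoint E.δ c) (s := 0) (by rw [dist_self]) hp hy
    linarith
  -- the corner after `x₀` starts in the ball; the run's end is `x₀`
  have hn1src : cSrc (cornerOrbit β₀ a (n + 1)) = cTgt (cornerOrbit β₀ a n) := by
    rw [cornerOrbit_succ, cSrc_nextCorner]
  have hn1near : dist (meshPoint E.δ (cornerOrbit β₀ a (n + 1)).1) (meshPoint E.δ (cornerOrbit β₀ a n).1) ≤ E.δ := by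
    have h := dist_meshPoint_cornerOrbit_succ_le β₀ a E.δ n
    rw [abs_of_pos hδ] at h
    exact h
  have hTself : dist (meshPoint E.δ (cornerOrbit β₁ a' T).1) (meshPoint E.δ (cornerOrbit β₀ a n).1) ≤ E.δ := by
    rw [hmergeT, dist_self]; exact hδ.le
  -- the marked edge `cSrc a` at `E.δ a.1`, the marked edge `cSrc a'` of the translate near `a'.1`
  have hmk0 : ∃ e₀ : Sym2 (Site 2), (e₀ ∈ E.zdABEdges ∨ e₀ ∈ (shiftData E w).zdABEdges) ∧ dist (medialPoint E.δ e₀) (meshPoint E.δ a.1) ≤ E.δ :=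
    ⟨cSrc a, Or.inl (DiscreteDobrushin.cSrc_mem_zdABEdges ha.mem_zdArcA ha.mem_zdArcB (Or.inl ha.isOutEdge)), dist_medialPoint_cSrc_le' hδ.le a⟩
  have hmk' : ∀ (c : ℂ) (X : ℝ), dist (meshPoint E.δ a'.1) c ≤ X → ∃ e₀ : Sym2 (Site 2), (e₀ ∈ E.zdABEdges ∨ e₀ ∈ (shiftData E w).zdABEdges) ∧
      dist (medialPoint E.δ e₀) c ≤ X + E.δ := by
    intro c X hX
    refine ⟨cSrc a', Or.inr (DiscreteDobrushin.cSrc_mem_zdABEdges ha'.mem_zdArcA ha'.mem_zdArcB (Or.inl ha'.isOutEdge)), ?_⟩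
    have h1 : dist (medialPoint E.δ (cSrc a')) (meshPoint E.δ a'.1) ≤ E.δ := dist_medialPoint_cSrc_le' hδ.le a'
    have h2 := dist_triangle (medialPoint E.δ (cSrc a')) (meshPoint E.δ a'.1) c
    linarith
  -- the whole run is a long strand at `E.δ a.1`
  have hR1 : 0 ≤ T ∧ ((dist (meshPoint E.δ (cornerOrbit β₁ a' 0).1) (meshPoint E.δ a.1) ≤ (5 * η) ∧ (ρ / 2 / 2) ≤ dist (meshPoint E.δ (cornerOrbit β₁ a' T).1) (meshPoint E.δ a.1)) ∨ ((ρ / 2 / 2) ≤ dist (meshPoint E.δ (cornerOrbit β₁ a' 0).1) (meshPoint E.δ a.1) ∧ dist (meshPoint E.δ (cornerOrbit β₁ a' T).1) (meshPoint E.δ a.1) ≤ (5 * η))) ∧ (∀ t, 0 ≤ t → t ≤ T → (shiftData E w).IsInnerFace (cFace (cornerOrbit β₁ a' t))) ∧ (∀ s t, 0 ≤ s → s < t → t ≤ T → cornerOrbit β₁ a' s ≠ cornerOrbit β₁ a' t) := by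
    refine ⟨Nat.zero_le _, Or.inl ⟨?_, hfar _ _ _ hcola hball hTself⟩, fun t _ ht => hface₁ t ht, fun s t _ hst ht => hsimple₁ s t hst ht⟩
    show dist (meshPoint E.δ a'.1) (meshPoint E.δ a.1) ≤ 5 * η
    linarith
  -- FIRST return of the continuation to the run, if any
  by_cases hP : ∃ u', n < u' ∧ u' ≤ u ∧ ∃ k ≤ T, cornerOrbit β₀ a u' = cornerOrbit β₁ a' k
  · obtain ⟨u₁, ⟨hnu₁, hu₁u, k', hk'T, hEq⟩, hmin⟩ : ∃ u₁, (n < u₁ ∧ u₁ ≤ u ∧ ∃ k ≤ T, cornerOrbit β₀ a u₁ = cornerOrbit β₁ a' k) ∧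
        ∀ u'', u'' < u₁ → ¬ (n < u'' ∧ u'' ≤ u ∧ ∃ k ≤ T, cornerOrbit β₀ a u'' = cornerOrbit β₁ a' k) :=
      ⟨Nat.find hP, Nat.find_spec hP, fun u'' h => Nat.find_min hP h⟩
    have hfree : ∀ u'', n < u'' → u'' < u₁ → ∀ k ≤ T, cornerOrbit β₀ a u'' ≠ cornerOrbit β₁ a' k :=
      fun u'' h1 h2 k hk h => hmin u'' h2 ⟨h1, by omega, k, hk, h⟩
    -- `k' < T`
    have hk' : k' < T := by
      rcases lt_or_eq_of_le hk'T with h | h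
      · exact h
      · exact absurd ((h ▸ hEq).trans hmergeT).symm (hsimple n u₁ hnu₁ hu₁u)
    -- `u₁ ≥ n + 2`: the corner after `x₀` starts in the ball
    have hu₁ : n + 2 ≤ u₁ := by
      by_contra h
      have hu₁eq : u₁ = n + 1 := by omega
      rw [hu₁eq] at hEq
      rcases Nat.eq_zero_or_pos k' with hk0 | hkpos
      · -- `O₀ a (n+1) = a'`: the translate's marked edge would be in the ball
        rw [hk0] at hEq
        have hsrc : cSrc a' = cTgt (cornerOrbit β₀ a n) := by rw [← hn1src, hEq]; rfl
        have hmid : medialPoint E.δ (cSrc a') ∈ ball (meshPoint E.δ v) ρ := by rw [hsrc]; exact hball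
        rw [mem_ball] at hmid
        have h1 : dist (medialPoint E.δ (cSrc a')) (meshPoint E.δ a'.1) ≤ E.δ := dist_medialPoint_cSrc_le' hδ.le a'
        have h2 := infDist_le_infDist_add_dist (x := medialPoint E.δ (cSrc a')) (y := meshPoint E.δ a.1) (s := D.carrierᶜ)
        have h3 := infDist_le_infDist_add_dist (x := meshPoint E.δ v) (y := medialPoint E.δ (cSrc a')) (s := D.carrierᶜ)
        have h4 := dist_triangle (medialPoint E.δ (cSrc a')) (meshPoint E.δ a'.1) (meshPoint E.δ a.1)
        rw [dist_comm] at hmid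
        linarith
      · obtain ⟨k'', rfl⟩ : ∃ k'', k' = k'' + 1 := ⟨k' - 1, by omega⟩
        have hsrc : cTgt (cornerOrbit β₁ a' k'') = cTgt (cornerOrbit β₀ a n) := by
          rw [← hn1src, hEq, cornerOrbit_succ, cSrc_nextCorner]
        exact (hrun k'' (by omega)).1 (by rw [hsrc]; exact hball)
    -- the predecessor of the return on the continuation (off the run, by firstness)
    set p₀ := cornerOrbit β₀ a (u₁ - 1) with hp₀
    have hp₀succ : nextCorner β₀ p₀ = cornerOrbit β₀ a u₁ := by
      rw [hp₀, ← cornerOrbit_succ, Nat.sub_add_cancel (by omega)]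
    have hp₀D : meshPoint E.δ p₀.1 ∈ D.carrier := hzD (u₁ - 1) (by omega)
    have hS2far : ρ / 2 / 2 ≤ dist (meshPoint E.δ (cornerOrbit β₀ a (n + 1)).1) (meshPoint E.δ a.1) :=
      hfar _ _ _ hcola hball hn1near
    rcases Nat.eq_zero_or_pos k' with hk0 | hkpos
    · -- passage through `a'`: NEAR at the start vertex `a.1`
      rw [hk0] at hEq
      have hp₀tgt : cTgt p₀ = cSrc a' := by rw [← cSrc_nextCorner, hp₀succ, hEq]; rfl
      have hp₀near : dist (meshPoint E.δ p₀.1) (meshPoint E.δ a.1) ≤ 5 * η := by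
        have h := dist_meshPoint_le_of_mem_cSrc_DM hδ.le (p := a') (y := p₀.1) (by rw [← hp₀tgt]; exact Sym2.mem_mk_left _ _)
        have h2 := dist_triangle (meshPoint E.δ p₀.1) (meshPoint E.δ a'.1) (meshPoint E.δ a.1)
        linarith
      refine ⟨meshPoint E.δ a.1, haD, hcola, ?_⟩
      have hS2 : (n + 1) ≤ (u₁ - 1) ∧ ((dist (meshPoint E.δ (cornerOrbit β₀ a (n + 1)).1) (meshPoint E.δ a.1) ≤ (5 * η) ∧ (ρ / 2 / 2) ≤ dist (meshPoint E.δ (cornerOrbit β₀ a (u₁ - 1)).1) (meshPoint E.δ a.1)) ∨ ((ρ / 2 / 2) ≤ dist (meshPoint E.δ (cornerOrbit β₀ a (n + 1)).1) (meshPoint E.δ a.1) ∧ dist (meshPoint E.δ (cornerOrbit β₀ a (u₁ - 1)).1) (meshPoint E.δ a.1) ≤ (5 * η))) ∧ (∀ t, (n + 1) ≤ t → t ≤ (u₁ - 1) → E.IsInnerFace (cFace (cornerOrbit β₀ a t))) ∧ (∀ s t, (n + 1) ≤ s → s < t → t ≤ (u₁ - 1) → cornerOrbit β₀ a s ≠ cornerOrbit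 β₀ a t) :=
        ⟨by omega, Or.inr ⟨hS2far, hp₀near⟩, fun t _ ht => hfaceE t (by omega), fun s t _ hst ht => hsimple s t hst (by omega)⟩
      have hR12 : ∀ s t, 0 ≤ s → s ≤ T → (n + 1) ≤ t → t ≤ (u₁ - 1) → cornerOrbit β₁ a' s ≠ cornerOrbit β₀ a t :=
        fun s t _ hsT ht1 ht h => hfree t (by omega) (by omega) s hsT h.symm
      exact mem_ufrsCert_of_two_far_at_marked_ST false true a' a 0 T (n + 1) (u₁ - 1) hη hδη hmk0 hR1 hS2 hR12
    · -- a merge at the collar corner `p₀`, with `p₁ = O₁ a' (k' - 1)`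
      set p₁ := cornerOrbit β₁ a' (k' - 1) with hp₁
      have hp₁succ : nextCorner β₁ p₁ = cornerOrbit β₁ a' k' := by
        rw [hp₁, ← cornerOrbit_succ, Nat.sub_add_cancel hkpos]
      have hne : p₀ ≠ p₁ := fun h => hfree (u₁ - 1) (by omega) (by omega) (k' - 1) (by omega) (by rw [← hp₀, h])
      have hnext : nextCorner β₀ p₀ = nextCorner β₁ p₁ := by rw [hp₀succ, hp₁succ, hEq]
      obtain ⟨hcol, htgt, -⟩ := hmerge E hEΩ hE hδ₁' w hw ω p₀ p₁ hne hnext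
      refine ⟨meshPoint E.δ p₀.1, hp₀D, hcol, ?_⟩
      have hδ4 : E.δ ≤ 4 * η := by linarith
      -- strand 1: `O₁ a' [k', T]`, from the merge to the ball
      have hS1near : dist (meshPoint E.δ (cornerOrbit β₁ a' k').1) (meshPoint E.δ p₀.1) ≤ 4 * η := by
        have hmem : (cornerOrbit β₁ a' k').1 ∈ cTgt p₀ := by
          rw [htgt, ← cSrc_nextCorner, hp₁succ]; exact Sym2.mem_mk_left _ _
        exact (dist_meshPoint_le_of_mem_cTgt_DM hδ.le hmem).trans hδ4
      have hS1 : ∀ R' : ℝ, R' ≤ ρ / 2 / 2 → k' ≤ T ∧ ((dist (meshPoint E.δ (cornerOrbit β₁ a' k').1) (meshPoint E.δ p₀.1) ≤ (4 * η) ∧ R' ≤ dist (meshPoint E.δ (cornerOrbit β₁ a' T).1) (meshPoint E.δ p₀.1)) ∨ (R' ≤ dist (meshPoint E.δ (cornerOrbit β₁ a' k').1) (meshPoint E.δ p₀.1) ∧ dist (meshPoint E.δ (cornerOrbit β₁ a' T).1) (meshPoint E.δ p₀.1) ≤ (4 * η))) ∧ (∀ t, k' ≤ t → t ≤ T → (shiftData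 E w).IsInnerFace (cFace (cornerOrbit β₁ a' t))) ∧ (∀ s t, k' ≤ s → s < t → t ≤ T → cornerOrbit β₁ a' s ≠ cornerOrbit β₁ a' t) :=
        fun R' hR' => ⟨hk'T, Or.inl ⟨hS1near, hR'.trans (hfar _ _ _ hcol hball hTself)⟩, fun t _ ht => hface₁ t ht, fun s t _ hst htT => hsimple₁ s t hst htT⟩
      -- strand 2: `O₀ a [n + 1, u₁ - 1]`, from the ball to the merge
      have hS2near : dist (meshPoint E.δ (cornerOrbit β₀ a (u₁ - 1)).1) (meshPoint E.δ p₀.1) ≤ 4 * η := by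
        show dist (meshPoint E.δ p₀.1) (meshPoint E.δ p₀.1) ≤ 4 * η
        rw [dist_self]; positivity
      have hS2 : ∀ R' : ℝ, R' ≤ ρ / 2 / 2 → (n + 1) ≤ (u₁ - 1) ∧ ((dist (meshPoint E.δ (cornerOrbit β₀ a (n + 1)).1) (meshPoint E.δ p₀.1) ≤ (4 * η) ∧ R' ≤ dist (meshPoint E.δ (cornerOrbit β₀ a (u₁ - 1)).1) (meshPoint E.δ p₀.1)) ∨ (R' ≤ dist (meshPoint E.δ (cornerOrbit β₀ a (n + 1)).1) (meshPoint E.δ p₀.1) ∧ dist (meshPoint E.δ (cornerOrbit β₀ a (u₁ - 1)).1) (meshPoint E.δ p₀.1) ≤ (4 * η))) ∧ (∀ t, (n + 1) ≤ t → t ≤ (u₁ - 1) → E.IsInnerFace (cFace (cornerOrbit β₀ a t))) ∧ (∀ s t, (n + 1) ≤ s → s < t → t ≤ (u₁ - 1) → cornerOrbit β₀ a s ≠ cornerOrbit β₀ a t) :=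
        fun R' hR' => ⟨by omega, Or.inr ⟨hR'.trans (hfar _ _ _ hcol hball hn1near), hS2near⟩, fun t _ ht => hfaceE t (by omega), fun s t _ hst ht => hsimple s t hst (by omega)⟩
      have hS12 : ∀ s t, k' ≤ s → s ≤ T → (n + 1) ≤ t → t ≤ (u₁ - 1) → cornerOrbit β₁ a' s ≠ cornerOrbit β₀ a t :=
        fun s t _ hsT ht1 ht h => hfree t (by omega) (by omega) s hsT h.symm
      -- distance from the merge to the translate's start vertex
      have hp₁near : dist (meshPoint E.δ p₁.1) (meshPoint E.δ p₀.1) ≤ E.δ :=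
        dist_meshPoint_le_of_mem_cTgt_DM hδ.le (p := p₀) (y := p₁.1) (by rw [htgt]; exact Sym2.mem_mk_left _ _)
      rcases Nat.lt_or_ge k' 2 with hk1 | hk2
      · -- `k' = 1`: the merge is at the translate's start corner, its marked edge is within `2 E.δ`
        have hk1' : k' = 1 := by omega
        have hp₁a : p₁ = a' := by rw [hp₁, hk1']; rfl
        have hX : dist (meshPoint E.δ a'.1) (meshPoint E.δ p₀.1) ≤ E.δ := by rw [← hp₁a]; exact hp₁near
        have hXlt : E.δ < ρ / 2 / 2 := by linarith
        exact mem_ufrsCert_of_two_far_and_marked_W3H false true false a' a a' k' T (n + 1) (u₁ - 1) 0 0 hη hδη hXlt (hmk' _ _ hX) hS1 hS2 hS12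
          (fun hbig => False.elim (by linarith))
      · -- strand 3: `O₁ a' [0, k' - 2]`, read back to the translate's start corner
        have hS3near : dist (meshPoint E.δ (cornerOrbit β₁ a' (k' - 2)).1) (meshPoint E.δ p₀.1) ≤ 4 * η := by
          have h := dist_meshPoint_cornerOrbit_succ_le β₁ a' E.δ (k' - 2)
          rw [abs_of_pos hδ, show k' - 2 + 1 = k' - 1 by omega, dist_comm] at h
          have h2 := dist_triangle (meshPoint E.δ (cornerOrbit β₁ a' (k' - 2)).1) (meshPoint E.δ p₁.1) (meshPoint E.δ p₀.1)
          linarith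
        have hS3 : ∀ R' : ℝ, R' ≤ dist (meshPoint E.δ a'.1) (meshPoint E.δ p₀.1) → 0 ≤ (k' - 2) ∧ ((dist (meshPoint E.δ (cornerOrbit β₁ a' 0).1) (meshPoint E.δ p₀.1) ≤ (4 * η) ∧ R' ≤ dist (meshPoint E.δ (cornerOrbit β₁ a' (k' - 2)).1) (meshPoint E.δ p₀.1)) ∨ (R' ≤ dist (meshPoint E.δ (cornerOrbit β₁ a' 0).1) (meshPoint E.δ p₀.1) ∧ dist (meshPoint E.δ (cornerOrbit β₁ a' (k' - 2)).1) (meshPoint E.δ p₀.1) ≤ (4 * η))) ∧ (∀ t, 0 ≤ t → t ≤ (k' - 2) → (shiftData E w).IsInnerFace (cFace (cornerOrbit β₁ a' t))) ∧ (∀ s t, 0 ≤ s → s < t → t ≤ (k' - 2) → cornerOrbit β₁ a' s ≠ cornerOrbit β₁ a' t) :=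
          fun R' hR' => ⟨Nat.zero_le _, Or.inr ⟨hR', hS3near⟩, fun t _ ht => hface₁ t (by omega), fun s t _ hst ht => hsimple₁ s t hst (by omega)⟩
        have hS13 : ∀ s t, k' ≤ s → s ≤ T → 0 ≤ t → t ≤ (k' - 2) → cornerOrbit β₁ a' s ≠ cornerOrbit β₁ a' t :=
          fun s t hs hsT _ ht h => hsimple₁ t s (by omega) hsT h.symm
        have hS23 : ∀ s t, (n + 1) ≤ s → s ≤ (u₁ - 1) → 0 ≤ t → t ≤ (k' - 2) → cornerOrbit β₀ a s ≠ cornerOrbit β₁ a' t :=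
          fun s t hs hsu _ ht h => hfree s (by omega) (by omega) t (by omega) h
        by_cases hXfar : ρ / 2 / 2 ≤ dist (meshPoint E.δ a'.1) (meshPoint E.δ p₀.1)
        · exact mem_ufrsCert_of_three_far_W3H false true false a' a a' k' T (n + 1) (u₁ - 1) 0 (k' - 2) hη hesc (hS1 _ le_rfl) (hS2 _ le_rfl)
            (hS3 _ hXfar) hS12 hS13 hS23
        · rw [not_le] at hXfar
          exact mem_ufrsCert_of_two_far_and_marked_W3H false true false a' a a' k' T (n + 1) (u₁ - 1) 0 (k' - 2) hη hδη hXfar (hmk' _ _ le_rfl)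
            hS1 hS2 hS12 (fun _ => ⟨hS3 _ le_rfl, hS13, hS23⟩)
  · -- no return before `u`: the continuation reaches the `4η`-ball of the translate's start vertex off the run
    have hfree : ∀ u'', n < u'' → u'' ≤ u → ∀ k ≤ T, cornerOrbit β₀ a u'' ≠ cornerOrbit β₁ a' k :=
      fun u'' h1 h2 k hk h => hP ⟨u'', h1, h2, k, hk, h⟩
    have hnear : dist (meshPoint E.δ (cornerOrbit β₀ a u).1) (meshPoint E.δ a.1) ≤ 5 * η := by
      rcases hret with ⟨k, hk, h⟩ | h
      · exact absurd h (hfree u hnu le_rfl k hk)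
      · have h2 := dist_triangle (meshPoint E.δ (cornerOrbit β₀ a u).1) (meshPoint E.δ a'.1) (meshPoint E.δ a.1)
        linarith
    refine ⟨meshPoint E.δ a.1, haD, hcola, ?_⟩
    have hS2 : (n + 1) ≤ u ∧ ((dist (meshPoint E.δ (cornerOrbit β₀ a (n + 1)).1) (meshPoint E.δ a.1) ≤ (5 * η) ∧ (ρ / 2 / 2) ≤ dist (meshPoint E.δ (cornerOrbit β₀ a u).1) (meshPoint E.δ a.1)) ∨ ((ρ / 2 / 2) ≤ dist (meshPoint E.δ (cornerOrbit β₀ a (n + 1)).1) (meshPoint E.δ a.1) ∧ dist (meshPoint E.δ (cornerOrbit β₀ a u).1) (meshPoint E.δ a.1) ≤ (5 * η))) ∧ (∀ t, (n + 1) ≤ t → t ≤ u → E.IsInnerFace (cFace (cornerOrbit β₀ a t))) ∧ (∀ s t, (n + 1) ≤ s → s < t → t ≤ u → cornerOrbit β₀ a s ≠ cornerOrbit β₀ a t) :=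
      ⟨hnu, Or.inr ⟨hfar _ _ _ hcola hball hn1near, hnear⟩, fun t _ ht => hfaceE t ht, fun s t _ hst ht => hsimple s t hst ht⟩
    have hR12 : ∀ s t, 0 ≤ s → s ≤ T → (n + 1) ≤ t → t ≤ u → cornerOrbit β₁ a' s ≠ cornerOrbit β₀ a t :=
      fun s t _ hsT ht1 ht h => hfree t (by omega) ht s hsT h.symm
    exact mem_ufrsCert_of_two_far_at_marked_ST false true a' a 0 T (n + 1) u hη hδη hmk0 hR1 hS2 hR12

end

end Summit.CriticalPhenomena.CardyFormulaZ2.Cruxes.EdgePrecompact.QkzStripBoundaryArm
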